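import Summits.ValiantsHypothesis.ValiantsHypothesis.Theorems.MonotoneRestorationOrbitRestorationQPWaringJennrichAffine
import HarnessLib

/-!
# Powers of pairwise non-proportional linear forms are independent (Sylvester), toward A_∞

Route MonotoneRestoration, crux `OrbitRestorationQP` (stmt-ValiantsHypothesis-18293), line `depth-three-rung`,
stub A_∞ `stub_sigmaPiSigmaValue`.  Namespace `Summit.ValiantsHypothesis.ValiantsHypothesis.Theorems.WaringJennrich`.

The Jennrich stratum (`…WaringJennrich*.lean`) needs linearly independent forms, hence at most `n²` terms.
The second identifiable regime of ΣΛΣ is Sylvester's: FEW terms relative to the DEGREE, with no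
independence at all.  Its engine is the classical fact proved here:

* `exists_pair_eq_zero_ne_zero` — a form not proportional to `q'` is detected by a direction killing `q'`;
* `linearIndependent_pow_of_nonproportional` — **if `q_1, …, q_s` are nonzero, pairwise non-proportional
  coefficient vectors and `s ≤ d + 1`, then the powers `ℓ_{q_1}^d, …, ℓ_{q_s}^d` are linearly independent**
  (induction on `s`: differentiate along a direction killing exactly the last form — such a direction exists
  over an infinite field by `Module.Dual.exists_forall_mem_ne_zero_of_forall_exists` — and lower the degree);
* `linearIndependent_pow_of_nonproportional'` — the same for a family indexed by any finite type.

Consequence recorded for the census (not yet formalised): an invariant `f = Σ_{i<r} a_i ℓ_{w_i}^d` with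
pairwise non-proportional `w_i` and `2r ≤ d + 1` is identifiable along the group (the `2r` powers
`ℓ_{w_i}^d, ℓ_{σ·w_j}^d` not matched in proportional pairs would be independent), hence restorable by
`qpOrbitRestorable_of_identifiableWaring`.  Everything here is proved. [folklore; Sylvester 1851 for binary forms]
-/

noncomputable section

open scoped Classical

-- `Summit.ValiantsHypothesis.ValiantsHypothesis.…` is the tree's single-conjunct layout (Sub = Summit).
set_option linter.dupNamespace false

namespace Summit.ValiantsHypothesis.ValiantsHypothesis.Theorems

namespace WaringJennrich

open MvPolynomial Finset

universe u v

variable {K : Type u} [Field K] {X : Type v} [Fintype X]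

/-! ### Pairings with coordinate directions; `lin` is injective -/

/-- Pairing with the coordinate direction `e_x` evaluates the coefficient at `x`. [folklore] -/
theorem pair_single (q : X → K) (x : X) : pair q (fun y => if x = y then 1 else 0) = q x := by
  simp only [pair, mul_ite, mul_one, mul_zero, Finset.sum_ite_eq, Finset.mem_univ, if_true]

/-- `pair` is additive in the direction. [folklore] -/
theorem pair_sub_right (q u u' : X → K) : pair q (u - u') = pair q u - pair q u' := by
  simp only [pair, Pi.sub_apply, mul_sub, Finset.sum_sub_distrib]

/-- `pair` commutes with scaling of the direction. [folklore] -/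
theorem pair_smul_right (q : X → K) (t : K) (u : X → K) : pair q (t • u) = t * pair q u := by
  simp only [pair, Pi.smul_apply, smul_eq_mul, Finset.mul_sum, mul_left_comm]

/-- `pair q` is the linear functional `Fintype.linearCombination K q`. [folklore] -/
theorem pair_eq_linearCombination (q u : X → K) : pair q u = Fintype.linearCombination K q u := by
  rw [Fintype.linearCombination_apply]
  simp only [pair, smul_eq_mul, mul_comm]

/-- A nonzero coefficient vector gives a nonzero linear form. [folklore] -/
theorem lin_ne_zero {q : X → K} (hq : q ≠ 0) : lin q ≠ 0 := by
  intro h0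
  apply hq
  funext x
  have h := congrArg (D (fun y => if x = y then (1 : K) else 0)) h0
  rw [D_lin, map_zero, pair_single, C_eq_zero] at h
  exact h

/-- **Separation**: if `q` is not a multiple of `q'`, some direction kills `q'` but not `q`. [folklore] -/
theorem exists_pair_eq_zero_ne_zero (q q' : X → K) (h : ∀ c : K, q ≠ c • q') :
    ∃ u : X → K, pair q' u = 0 ∧ pair q u ≠ 0 := by
  by_cases hq' : q' = 0
  · have hq : q ≠ 0 := fun h0 => h 0 (by rw [h0, zero_smul])
    obtain ⟨x, hx⟩ : ∃ x, q x ≠ 0 := by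
      by_contra hcon
      push Not at hcon
      exact hq (funext hcon)
    exact ⟨fun y => if x = y then 1 else 0, by rw [hq']; simp [pair], by rwa [pair_single]⟩
  · obtain ⟨x₀, hx₀⟩ : ∃ x, q' x ≠ 0 := by
      by_contra hcon
      push Not at hcon
      exact hq' (funext hcon)
    obtain ⟨y, hy⟩ : ∃ y, q y ≠ q x₀ / q' x₀ * q' y := by
      by_contra hcon
      push Not at hcon
      exact h (q x₀ / q' x₀) (funext fun y => by rw [Pi.smul_apply, smul_eq_mul]; exact hcon y)
    refine ⟨(fun z => if y = z then 1 else 0) - (q' y / q' x₀) • (fun z => if x₀ = z then 1 else 0), ?_, ?_⟩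
    · rw [pair_sub_right, pair_smul_right, pair_single, pair_single, div_mul_cancel₀ _ hx₀, sub_self]
    · rw [pair_sub_right, pair_smul_right, pair_single, pair_single]
      intro h0
      apply hy
      rw [sub_eq_zero.mp h0]
      ring

/-! ### Sylvester: independence of powers of pairwise non-proportional forms -/

variable [CharZero K] [Infinite K]

/-- **Powers of at most `d + 1` nonzero, pairwise non-proportional linear forms are linearly independent.**
[folklore; Sylvester] -/
theorem linearIndependent_pow_of_nonproportional :
    ∀ (s d : ℕ) (q : Fin s → X → K), s ≤ d + 1 → (∀ i, q i ≠ 0) →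
      (∀ i i', i ≠ i' → ∀ c : K, q i ≠ c • q i') → LinearIndependent K fun i => lin (q i) ^ d
  | 0, _, _, _, _, _ => linearIndependent_empty_type
  | s + 1, d, q, hs, hq, hnp => by
      rw [Fintype.linearIndependent_iff]
      intro g hg
      rcases Nat.eq_zero_or_pos d with rfl | hd
      · -- one form, degree 0
        have hs0 : s = 0 := by omega
        subst hs0
        intro i
        have hi : i = 0 := Fin.fin_one_eq_zero i
        subst hi
        rw [Fin.sum_univ_one, pow_zero, smul_eq_C_mul, mul_one, C_eq_zero] at hg
        exact hg
      -- a direction killing the last form and none of the others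
      obtain ⟨u, hu0, hu⟩ : ∃ u : X → K, pair (q (Fin.last s)) u = 0 ∧
          ∀ i : Fin s, pair (q i.castSucc) u ≠ 0 := by
        obtain ⟨u, hu0, hu⟩ := Module.Dual.exists_forall_mem_ne_zero_of_forall_exists
          (LinearMap.ker (Fintype.linearCombination K (q (Fin.last s))))
          (fun i : Fin s => Fintype.linearCombination K (q i.castSucc)) (fun i => by
            obtain ⟨u, h1, h2⟩ := exists_pair_eq_zero_ne_zero (q i.castSucc) (q (Fin.last s))
              (hnp _ _ (Fin.castSucc_lt_last i).ne)
            exact ⟨u, by rw [LinearMap.mem_ker, ← pair_eq_linearCombination]; exact h1,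
              by rw [← pair_eq_linearCombination]; exact h2⟩)
        refine ⟨u, ?_, fun i => ?_⟩
        · rw [LinearMap.mem_ker, ← pair_eq_linearCombination] at hu0; exact hu0
        · have h := hu i; rwa [← pair_eq_linearCombination] at h
      -- differentiate the relation along `u`
      have hg' : ∑ i, C (g i) * lin (q i) ^ d = 0 := by
        rw [← hg]; exact Finset.sum_congr rfl fun i _ => (smul_eq_C_mul _ _).symm
      have hD := congrArg (D u) hg'
      rw [map_zero, show D u (∑ i, C (g i) * lin (q i) ^ d) = (D u)^[1] (∑ i, C (g i) * lin (q i) ^ d)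
        from rfl, iterate_D_sum, Fin.sum_univ_castSucc, hu0, pow_one, mul_zero, map_zero, zero_mul,
        add_zero] at hD
      -- induction hypothesis on the first `s` forms in degree `d - 1`
      have IH := linearIndependent_pow_of_nonproportional s (d - 1) (fun i => q i.castSucc) (by omega)
        (fun i => hq _) (fun i i' hii' => hnp _ _ fun h => hii' (Fin.castSucc_injective _ h))
      rw [Fintype.linearIndependent_iff] at IH
      have hcoef := IH (fun i => g i.castSucc * (d.descFactorial 1 : K) * pair (q i.castSucc) u ^ 1)
        (by rw [← hD]; exact Finset.sum_congr rfl fun i _ => smul_eq_C_mul _ _)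
      have hcs : ∀ i : Fin s, g i.castSucc = 0 := by
        intro i
        have h := hcoef i
        simp only [Nat.descFactorial_one, pow_one, mul_eq_zero, Nat.cast_eq_zero] at h
        rcases h with (h | h) | h
        · exact h
        · omega
        · exact absurd h (hu i)
      -- the last coefficient
      intro i
      refine Fin.lastCases ?_ (fun i => hcs i) i
      rw [Fin.sum_univ_castSucc, Finset.sum_eq_zero (fun i _ => by rw [hcs i, zero_smul]), zero_add] at hg
      exact (smul_eq_zero.mp hg).resolve_right (pow_ne_zero _ (lin_ne_zero (hq _)))

/-- **Sylvester's independence for a family indexed by any finite type.** [folklore] -/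
theorem linearIndependent_pow_of_nonproportional' {ι : Type*} [Fintype ι] {d : ℕ} (q : ι → X → K)
    (hs : Fintype.card ι ≤ d + 1) (hq : ∀ i, q i ≠ 0) (hnp : ∀ i i', i ≠ i' → ∀ c : K, q i ≠ c • q i') :
    LinearIndependent K fun i => lin (q i) ^ d := by
  let e := (Fintype.equivFin ι).symm
  have h := linearIndependent_pow_of_nonproportional (Fintype.card ι) d (q ∘ e) hs (fun i => hq _)
    (fun i i' hii' => hnp _ _ fun h => hii' (e.injective h))
  exact (linearIndependent_equiv e).mp h

end WaringJennrich

end Summit.ValiantsHypothesis.ValiantsHypothesis.Theorems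

end
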